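import Summits.Ventures.HSemireg.WedgeHankelRecurrenceRealRootsSubresultant
import Literature.LinearAlgebra.Matrix.HadamardProductRank
import Mathlib.Analysis.Matrix.Order

/-!
# Venture HSemireg — SCHUR'S PRODUCT THEOREM AND THE HADAMARD RANK BOUND FOR HANKEL FORMS: the Hankel sections of a termwise product are the Hadamard products, **`H_t(a·b) = H_t(a) ⊙ H_t(b)`**,
# so **`rank H_t(a·b) ≤ rank H_t(a) · rank H_t(b)`** over any field (Literature `rank (A ⊙ B) ≤ rank A · rank B`, Brouwer–Haemers 11.4.3, CITED) and (Mathlib's Schur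
# product theorem) **positive (semi)definite real Hankel sections are closed under termwise products and powers** — in the lineage's census language `sigPos H_t(a) = sigPos H_t(b) = t + 1 ⇒
# sigPos H_t(a·b) = t + 1`, «all leading minors positive» is preserved, with the bridge `Matrix.PosDef H_t(q) ⟺ sigPos H_t(q) = t + 1` and a Newton-sum application

HONEST FRAMING. Part of the Lean index of the computation cell `pub-hsemireg` (seat p10 gen 37, Sunday typer «UNIFORM-IN-n»).
LINEAR ALGEBRA OF HANKEL MATRICES OVER `ℝ` (and the Hadamard identity over any type with `Mul`) ONLY (`Matrix.PosDef ∕ PosSemidef`, Mathlib's `sigPos`; Mathlib's Schur product theorem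
`Matrix.PosSemidef.hadamard ∕ Matrix.PosDef.hadamard` IMPORTED from `Mathlib.Analysis.Matrix.Order`; PROVED Literature `HadamardProductRank.rank_hadamard_le` (Brouwer–Haemers
*Spectra of Graphs* Thm 11.4.3, `Literature.LinearAlgebra.Matrix.HadamardProductRank`) and `sigPos_eq_finrank_of_posDef` (through N159) IMPORTED AND CITED): no variety, no cohomology theory,
no sheaf, no Ext group and no semiregularity map is constructed here; nothing here says that HC / HC_CM / HC_AV holds; no Literature fact (unproved `Prop`) is declared or used.  Custodian versions
as in `WedgeHankelSiegelIdeal` (1/3).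
SOURCES: I. Schur, *Bemerkungen zur Theorie der beschränkten Bilinearformen mit unendlich vielen Veränderlichen*, J. reine angew. Math. 140 (1911) 1–28 (the product theorem; Mathlib's citation
`schur1911`); the reading for moment ∕ Hankel forms (termwise products of positive definite Hankel sequences are positive definite — e.g. the moments of a product of independent variables) is
folklore; I cite no printed locus for it and claim none.
presearch: «Schur product theorem Hankel ∕ moment sequences termwise product» → [Mathlib] `Matrix.PosSemidef.hadamard`, `Matrix.PosDef.hadamard` (found by `rg` in `Mathlib/Analysis/Matrix/Order.lean`);
[tree] Literature uses of the Schur product theorem are graph ∕ optimisation files (`StronglyRegularKreinCondition`, `DeKlerkPasechnikThetaDual`), none about Hankel matrices; corpus ∕ galaxy not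
re-queried (the statement is Mathlib's).
DEDUP DISCLOSURE (`rg` of the whole tree + Mathlib, 2026-09-02): no `WedgeHankelRecurrence*` file mentions `hadamard` ∕ `⊙`; N159 has `posDef_hankelSq_of_sigPos_eq` (one direction of the
bridge; the converse and the `iff` are new); the gen-31 leaf `WedgeHankelRecurrenceHadamard` is about Hadamard PRODUCTS OF SEQUENCES through Kauers–Paule (bounded eventual RANKS, `forall_rank_half_mul_le`) — positivity and
finite sections are not there; `rank (A ⊙ B) ≤ rank A · rank B` IS in the tree (`Literature/LinearAlgebra/Matrix/HadamardProductRank.lean`, found by `lean search` — cited, not restated).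
13 names: 0 hits tree-wide.

WHAT IS IN THE TREE.  N48 `CensusDet`: `hankelSq`; N159 `RealRootsSubresultant`: **`posDef_hankelSq_of_sigPos_eq`**, **`sigPos_hankelSq_eq_iff_forall_det_pos`**,
**`splits_and_separable_iff_forall_det_hankelSq_pos`**; Literature `SignatureContinuousFamily.sigPos_eq_finrank_of_posDef`, `DeterminantCharTwo.toQuadraticForm'_apply`; Mathlib:
**`Matrix.PosSemidef.hadamard`**, **`Matrix.PosDef.hadamard`**, `Matrix.posDef_iff_dotProduct_mulVec`; Literature **`HadamardProductRank.rank_hadamard_le`**.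
THIS FILE (namespace `Summit.Ventures.HSemireg.Wedge.HankelOuter` continued; PLAIN over N159 + `Literature.LinearAlgebra.Matrix.HadamardProductRank` + `Mathlib.Analysis.Matrix.Order`; 0 definitions):
* §837 `hankelSq_mul_eq_hadamard`, `hankelSq_mul_eq_hadamard'` (both `rfl`).
* §837b **`rank_hankelSq_mul_le`** (cited bound), `rank_hankelSq_pow_succ_le`.
* §838 `sigPos_hankelSq_eq_of_posDef`, **`posDef_hankelSq_iff_sigPos_eq`**, **`posSemidef_hankelSq_mul`**, **`posDef_hankelSq_mul`**, **`sigPos_hankelSq_mul_eq`**, `forall_det_hankelSq_mul_pos`,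
  `posDef_hankelSq_pow_succ`, `sigPos_hankelSq_pow_succ_eq`, `forall_det_hankelSq_dualSeq_derivative_mul_pos` (Newton sums of two real-rooted polynomials).
CAVEATS.  Positivity statements over `ℝ` (Mathlib's Schur theorem is stated for `RCLike` scalars; the lineage's positivity census N155 ∕ N159 is real); the rank bound over any field.
Nothing Ext-side.  New names only.
-/

open scoped Matrix

namespace Summit.Ventures.HSemireg.Wedge.HankelOuter

open Summit.Ventures.HSemireg.Wedge Summit.Ventures.HSemireg.Wedge.Hankel

section Hadamard

variable {K : Type*} [Field K]

/-! ## §837. The Hankel sections of a TERMWISE PRODUCT of sequences are the Hadamard products of the Hankel sections -/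

omit [Field K] in
/-- **`H_t(a · b) = H_t(a) ⊙ H_t(b)`** (entrywise: `(ab)_{i+j} = a_{i+j} b_{i+j}`). [this file, §837] -/
theorem hankelSq_mul_eq_hadamard [Mul K] (t : ℕ) (a b : ℕ → K) : hankelSq K t (a * b) = hankelSq K t a ⊙ hankelSq K t b := rfl

omit [Field K] in
/-- The same with the product written pointwise. [this file, §837] -/
theorem hankelSq_mul_eq_hadamard' [Mul K] (t : ℕ) (a b : ℕ → K) : hankelSq K t (fun n => a n * b n) = hankelSq K t a ⊙ hankelSq K t b := rfl

/-! ## §837b. THE RANK IS SUBMULTIPLICATIVE: `rank H_t(a·b) ≤ rank H_t(a) · rank H_t(b)` over any field (CITED: Literature `HadamardProductRank.rank_hadamard_le`, Brouwer–Haemers Thm 11.4.3: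
`rank (A ⊙ B) ≤ rank A · rank B`) -/

/-- **FINITE-SECTION HADAMARD BOUND: `rank H_t(a·b) ≤ rank H_t(a) · rank H_t(b)`** for every `t` and any field (the finite companion of the gen-31 leaf `WedgeHankelRecurrenceHadamard`'s bound on
EVENTUAL ranks, Kauers–Paule Thm. 4.2). [this file, §837b] -/
theorem rank_hankelSq_mul_le (t : ℕ) (a b : ℕ → K) : (hankelSq K t (a * b)).rank ≤ (hankelSq K t a).rank * (hankelSq K t b).rank := by
  rw [hankelSq_mul_eq_hadamard]; exact Literature.LinearAlgebra.Matrix.HadamardProductRank.rank_hadamard_le _ _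

/-- Powers: `rank H_t(n ↦ a_n^k) ≤ (rank H_t(a))^k` for `k ≥ 1` (and trivially `rank H_t(1) ≤ 1` … stated for `k + 1`). [this file, §837b] -/
theorem rank_hankelSq_pow_succ_le (t : ℕ) (a : ℕ → K) : ∀ k : ℕ, (hankelSq K t (a ^ (k + 1))).rank ≤ (hankelSq K t a).rank ^ (k + 1)
  | 0 => by rw [zero_add, pow_one, pow_one]
  | k + 1 => by
    rw [pow_succ, pow_succ (M := ℕ)]
    exact (rank_hankelSq_mul_le t _ a).trans (Nat.mul_le_mul_right _ (rank_hankelSq_pow_succ_le t a k))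

/-! ## §838. SCHUR'S PRODUCT THEOREM for Hankel forms over `ℝ`: termwise products of (strictly) Hankel-positive sequences are (strictly) Hankel-positive (Mathlib `Matrix.PosSemidef.hadamard`,
`Matrix.PosDef.hadamard`); in the lineage's language `sigPos H_t = t + 1` is preserved, and so is «all leading minors positive» -/

/-- Bridge, converse to N159 `posDef_hankelSq_of_sigPos_eq`: **a positive definite real Hankel section has `sigPos = t + 1`** (Literature `sigPos_eq_finrank_of_posDef`). [this file, §838] -/
theorem sigPos_hankelSq_eq_of_posDef {t : ℕ} {q : ℕ → ℝ} (h : (hankelSq ℝ t q).PosDef) : sigPos (hankelSq ℝ t q).toQuadraticForm' = t + 1 := by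
  have hQ : (hankelSq ℝ t q).toQuadraticForm'.PosDef := fun x hx => by
    rw [Literature.LinearAlgebra.QuadraticForm.DeterminantCharTwo.toQuadraticForm'_apply, ← star_trivial x]
    exact (Matrix.posDef_iff_dotProduct_mulVec.1 h).2 hx
  rw [Literature.LinearAlgebra.QuadraticForm.sigPos_eq_finrank_of_posDef hQ, Module.finrank_fin_fun]

/-- `Matrix.PosDef H_t(q) ⟺ sigPos H_t(q) = t + 1` (real sequences). [this file, §838] -/
theorem posDef_hankelSq_iff_sigPos_eq {t : ℕ} (q : ℕ → ℝ) : (hankelSq ℝ t q).PosDef ↔ sigPos (hankelSq ℝ t q).toQuadraticForm' = t + 1 :=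
  ⟨sigPos_hankelSq_eq_of_posDef, posDef_hankelSq_of_sigPos_eq q⟩

/-- **SCHUR for Hankel sections, semidefinite: `H_t(a), H_t(b) ⪰ 0 ⇒ H_t(a·b) ⪰ 0`.** [this file, §838] -/
theorem posSemidef_hankelSq_mul {t : ℕ} {a b : ℕ → ℝ} (ha : (hankelSq ℝ t a).PosSemidef) (hb : (hankelSq ℝ t b).PosSemidef) : (hankelSq ℝ t (a * b)).PosSemidef := by
  rw [hankelSq_mul_eq_hadamard]; exact ha.hadamard hb

/-- **SCHUR for Hankel sections, definite: `H_t(a), H_t(b) ≻ 0 ⇒ H_t(a·b) ≻ 0`.** [this file, §838] -/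
theorem posDef_hankelSq_mul {t : ℕ} {a b : ℕ → ℝ} (ha : (hankelSq ℝ t a).PosDef) (hb : (hankelSq ℝ t b).PosDef) : (hankelSq ℝ t (a * b)).PosDef := by
  rw [hankelSq_mul_eq_hadamard]; exact ha.hadamard hb

/-- **In the lineage's census language: `sigPos H_t(a) = sigPos H_t(b) = t + 1 ⇒ sigPos H_t(a·b) = t + 1`.** [this file, §838] -/
theorem sigPos_hankelSq_mul_eq {t : ℕ} {a b : ℕ → ℝ} (ha : sigPos (hankelSq ℝ t a).toQuadraticForm' = t + 1) (hb : sigPos (hankelSq ℝ t b).toQuadraticForm' = t + 1) :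
    sigPos (hankelSq ℝ t (a * b)).toQuadraticForm' = t + 1 :=
  sigPos_hankelSq_eq_of_posDef (posDef_hankelSq_mul (posDef_hankelSq_of_sigPos_eq a ha) (posDef_hankelSq_of_sigPos_eq b hb))

/-- **Leading minors: if `det H_k(a) > 0` and `det H_k(b) > 0` for all `k ≤ t`, then `det H_k(a·b) > 0` for all `k ≤ t`** (N159 `sigPos_hankelSq_eq_iff_forall_det_pos`). [this file, §838] -/
theorem forall_det_hankelSq_mul_pos {t : ℕ} {a b : ℕ → ℝ} (ha : ∀ k, k ≤ t → 0 < (hankelSq ℝ k a).det) (hb : ∀ k, k ≤ t → 0 < (hankelSq ℝ k b).det) :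
    ∀ k, k ≤ t → 0 < (hankelSq ℝ k (a * b)).det :=
  (sigPos_hankelSq_eq_iff_forall_det_pos (a * b)).1 (sigPos_hankelSq_mul_eq ((sigPos_hankelSq_eq_iff_forall_det_pos a).2 ha) ((sigPos_hankelSq_eq_iff_forall_det_pos b).2 hb))

/-- **Powers: `H_t(a) ≻ 0 ⇒ H_t(a^{k+1}) ≻ 0`** (termwise powers `n ↦ a_n^{k+1}`). [this file, §838] -/
theorem posDef_hankelSq_pow_succ {t : ℕ} {a : ℕ → ℝ} (ha : (hankelSq ℝ t a).PosDef) : ∀ k : ℕ, (hankelSq ℝ t (a ^ (k + 1))).PosDef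
  | 0 => by rwa [zero_add, pow_one]
  | k + 1 => by rw [pow_succ]; exact posDef_hankelSq_mul (posDef_hankelSq_pow_succ ha k) ha

/-- The census form of the powers statement: `sigPos H_t(a) = t + 1 ⇒ sigPos H_t(n ↦ a_n^{k+1}) = t + 1`. [this file, §838] -/
theorem sigPos_hankelSq_pow_succ_eq {t : ℕ} {a : ℕ → ℝ} (ha : sigPos (hankelSq ℝ t a).toQuadraticForm' = t + 1) (k : ℕ) :
    sigPos (hankelSq ℝ t (fun n => a n ^ (k + 1))).toQuadraticForm' = t + 1 := by
  have h := sigPos_hankelSq_eq_of_posDef (posDef_hankelSq_pow_succ (posDef_hankelSq_of_sigPos_eq a ha) k)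
  rwa [show (a ^ (k + 1) : ℕ → ℝ) = fun n => a n ^ (k + 1) from funext fun n => Pi.pow_apply a (k + 1) n] at h

/-- **An application inside the lineage (Hermite ∕ Borchardt–Jacobi, N155 ∕ N159): if `P` and `Q` are monic real of degree `t + 1`, each with `t + 1` distinct real roots, then the termwise
product of their Newton-sum ∕ `P′/P`-moment sequences still has ALL leading Hankel minors positive up to order `t + 1`** (a necessary condition satisfied by the power sums of the `(t+1)²`
products `α_i β_j`). [this file, §838] -/
theorem forall_det_hankelSq_dualSeq_derivative_mul_pos {t : ℕ} {P Q : Polynomial ℝ} (hP : P.Monic) (hPd : P.natDegree = t + 1) (hQ : Q.Monic) (hQd : Q.natDegree = t + 1)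
    (hPr : P.Splits ∧ P.Separable) (hQr : Q.Splits ∧ Q.Separable) :
    ∀ k, k ≤ t → 0 < (hankelSq ℝ k (dualSeq ℝ P (Polynomial.derivative P) * dualSeq ℝ Q (Polynomial.derivative Q))).det :=
  forall_det_hankelSq_mul_pos ((splits_and_separable_iff_forall_det_hankelSq_pos hP hPd).1 hPr) ((splits_and_separable_iff_forall_det_hankelSq_pos hQ hQd).1 hQr)

end Hadamard

end Summit.Ventures.HSemireg.Wedge.HankelOuter
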